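import Literature.AlgebraicGeometry.HodgeTheory.SupportedClassesIrreducible
import HarnessLib

/-!
# `Nˡ H²ˡ ∪ N¹ H² ⊆ Nˡ⁺¹ H²ˡ⁺²`: reduction of the divisor case to the hypersurface section through a prime divisor (proved)

Family `hodge`, layer `Literature/AlgebraicGeometry/HodgeTheory`. Companion of `AlgebraicClassesCup`
(`cupProduct_mem_algebraicClasses_of_moving`: Voisin II Prop. 9.20 on the coniveau carrier reduced to a
MOVING hypothesis on the first factor) and `SupportedClassesIrreducible` (only irreducible supports
matter). For the product of a codimension-`l` algebraic class with a DIVISOR class no Chow moving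
lemma is needed in print: the divisor moves in its linear system (W. Fulton, *Intersection Theory*
(1998), §2.3–2.4 and Cor. 19.2; C. Voisin, *Hodge Theory II* (2003), §9.2.4 and proof of Lemma 9.18,
"the class `[Z]` of a cycle `Z` vanishes on `X – Supp Z`"). This file proves the two reductions that
isolate the remaining algebro-geometric input as a statement about ONE prime divisor `W` and ONE
point `v ∈ W`:

* `cupProduct_mem_algebraicClasses_of_moving_right` — the reduction theorem with the rôles of the
  factors exchanged: it suffices to move the support of the SECOND (degree-`2k`) factor with
  respect to an irreducible support of the first (same bilinearity argument; no graded
  commutativity of `∪` is used);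
* `cupProduct_mem_algebraicClasses_one_of_forall_primeDivisor` — **if for every irreducible closed
  `W ⊆ X` of codimension `≥ 1` and every point `v ∈ W` there are Zariski-closed `W', T ∌ v` and a
  class `ψ` dying on `(X ∖ T)(ℂ)` with
  `ker (H²(X(ℂ)) → H²((X ∖ W)(ℂ))) ≤ ℂ · ψ + ker (H²(X(ℂ)) → H²((X ∖ W')(ℂ)))`, then
  `a ∈ Nˡ H²ˡ`, `d ∈ N¹ H²` imply `a ∪ d ∈ Nˡ⁺¹ H²ˡ⁺²`** (all `l`). In print `ψ` is the class of a
  hypersurface section `X ∩ V₊(F)` through `W`, vanishing to order one along `W`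
  (`X ∩ V₊(F) = W ∪ W'`), `T = X ∩ V₊(G)` a second hypersurface section (`[X ∩ V₊(F)] = [X ∩ V₊(G)]`,
  both `= deg · [H]`), and the inequality is the Lelong–Poincaré nondegeneracy "the component of
  `[X ∩ V₊(F)]` along `W` is `ord_W(F) · [W] ≠ 0`" together with purity
  (`SupportedClassesPurity`: the classes supported on `W` form a line); its topological heart is the
  tree's `ker_cohomologyMap_le_span_map_of_pairMap` (`SingularHomology/LocallyFlatPairMapLine`). Given
  `v` = the generic point of the irreducible support `Z` of `a`: if `v ∉ W` nothing moves (`Z ∩ W` is a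
  proper closed subset of `Z`, of codimension `≥ l + 1`); if `v ∈ W`, both `T` and `W'` miss `v`, so
  meet `Z` in codimension `≥ l + 1`.

Everything is proved; no definitions, no named facts (the hypothesis is explicit, as in
`cupProduct_mem_algebraicClasses_of_moving`).

## References

* [VoisinHodgeII2003] C. Voisin, Hodge Theory and Complex Algebraic Geometry II, CUP 2003, §9.2.3
  Lemma 9.18 (proof), §9.2.4 Prop. 9.20.
* [Fulton1998] W. Fulton, Intersection Theory, 2nd ed. 1998, §2.3–2.4, §19.1 Lemma 19.1.1, §19.2
  Cor. 19.2.
* [Hartshorne1977] R. Hartshorne, Algebraic Geometry, 1977, II Ex. 3.20 (codimension and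
  specialisation).
-/

noncomputable section

open CategoryTheory AlgebraicGeometry Set TopologicalSpace
open Literature.AlgebraicTopology.SingularHomology

namespace Literature.AlgebraicGeometry.HodgeTheory

section HodgeTheory

variable {n : ℕ} {X : Motives.SchemeOver ℂ}

/-- **Products of algebraic classes are algebraic as soon as the support of the SECOND factor can be
moved with respect to an irreducible support of the first** (the reduction of Voisin II Prop. 9.20
on the coniveau carrier, `cupProduct_mem_algebraicClasses_of_moving_isIrreducible`, with the rôles
of the factors exchanged). HYPOTHESIS: for `Z` irreducible closed with all points of codimension
`≥ l` and `W` irreducible closed with all points of codimension `≥ k`, every class of `H²ᵏ(X(ℂ); ℂ)`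
vanishing on `(X ∖ W)(ℂ)` lies in the span of classes vanishing off closed `T` with `Z ∩ T` of
codimension `≥ l + k` everywhere. CONCLUSION: `a ∈ Nˡ H²ˡ`, `b ∈ Nᵏ H²ᵏ ⟹ a ∪ b ∈ Nˡ⁺ᵏ`. Proof:
bilinearity of `∪`, `Nᵖ = Σ` of kernels over irreducible supports
(`algebraicClasses_eq_iSup_isIrreducible`), and the cup product with supports
(`cupProduct_mem_supportedClasses_of_inter`). [cite: VoisinHodgeII2003, §9.2.4 Prop. 9.20]
[cite: Fulton1998, §19.2 Cor. 19.2] -/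
theorem cupProduct_mem_algebraicClasses_of_moving_right (hX : Motives.IsSmoothProjective n X)
    {l k : ℕ}
    (hmove : ∀ ⦃Z W : Set X.left⦄, IsClosed Z → IsIrreducible Z →
      (∀ z ∈ Z, (l : ℕ∞) ≤ Order.coheight z) → IsClosed W → IsIrreducible W →
        (∀ w ∈ W, (k : ℕ∞) ≤ Order.coheight w) →
        LinearMap.ker (complexBetti.restrictCompl X W (2 * k)).hom ≤
          ⨆ (T : Set X.left) (_ : IsClosed T)
            (_ : ∀ t ∈ Z ∩ T, ((l + k : ℕ) : ℕ∞) ≤ Order.coheight t),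
            LinearMap.ker (complexBetti.restrictCompl X T (2 * k)).hom)
    {a : complexBetti X (2 * l)} {b : complexBetti X (2 * k)} (ha : a ∈ algebraicClasses X l)
    (hb : b ∈ algebraicClasses X k) :
    cupProduct (two_mul_add_two_mul l k) a b ∈ algebraicClasses X (l + k) := by
  -- (A) for `a` killed off an irreducible closed `Z` of codimension `≥ l`, every algebraic `b` works
  have hA : ∀ ⦃Z : Set X.left⦄, IsClosed Z → IsIrreducible Z →
      (∀ z ∈ Z, (l : ℕ∞) ≤ Order.coheight z) →
      ∀ ⦃a : complexBetti X (2 * l)⦄, complexBetti.restrictCompl X Z (2 * l) a = 0 →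
        algebraicClasses X k ≤ (algebraicClasses X (l + k)).comap
          (cupProduct (two_mul_add_two_mul l k) a) := by
    intro Z hZ hZi hZl a ha
    rw [algebraicClasses_eq_iSup_isIrreducible hX k]
    refine iSup_le fun W ↦ iSup_le fun hW ↦ iSup_le fun hWi ↦ iSup_le fun hWk ↦
      (hmove hZ hZi hZl hW hWi hWk).trans ?_
    refine iSup_le fun T ↦ iSup_le fun hT ↦ iSup_le fun hZT ↦ ?_
    intro b hb
    rw [Submodule.mem_comap]
    exact cupProduct_mem_supportedClasses_of_inter hZ hT hZT _ ha (LinearMap.mem_ker.mp hb)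
  -- (B) then every algebraic `a` works
  have hB : algebraicClasses X l ≤ (algebraicClasses X (l + k)).comap
      ((cupProduct (two_mul_add_two_mul l k)).flip b) := by
    rw [algebraicClasses_eq_iSup_isIrreducible hX l]
    refine iSup_le fun Z ↦ iSup_le fun hZ ↦ iSup_le fun hZi ↦ iSup_le fun hZl ↦ ?_
    intro a ha
    have hab := hA hZ hZi hZl (LinearMap.mem_ker.mp ha) hb
    rw [Submodule.mem_comap] at hab
    rw [Submodule.mem_comap, LinearMap.flip_apply]
    exact hab
  have h := hB ha
  rw [Submodule.mem_comap, LinearMap.flip_apply] at h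
  exact h

/-- **`Nˡ H²ˡ ∪ N¹ H² ⊆ Nˡ⁺¹ H²ˡ⁺²` from the hypersurface section through each prime divisor.** Let `X`
be smooth projective over `ℂ`. HYPOTHESIS (Lelong–Poincaré nondegeneracy with purity, pointwise): for
every irreducible Zariski-closed `W ⊆ X` with all points of codimension `≥ 1` and every point `v ∈ W`
there are Zariski-closed `W', T ⊆ X` not containing `v` and a class `ψ ∈ H²(X(ℂ); ℂ)` vanishing on
`(X ∖ T)(ℂ)` such that every class vanishing on `(X ∖ W)(ℂ)` lies in
`ℂ · ψ + ker (H²(X(ℂ)) → H²((X ∖ W')(ℂ)))` (in print: `ψ = [X ∩ V₊(F)] = [X ∩ V₊(G)]` for forms `F`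
through `W` with `ord_W F = 1`, `X ∩ V₊(F) = W ∪ W'`, and `G` not vanishing at `v`; Voisin II, proof of
Lemma 9.18; Fulton §2.4). CONCLUSION: `a ∈ Nˡ H²ˡ(X(ℂ); ℂ)`, `d ∈ N¹ H²(X(ℂ); ℂ) ⟹ a ∪ d ∈ Nˡ⁺¹`.
Proof: `cupProduct_mem_algebraicClasses_of_moving_right` with `k = 1`; for `Z` irreducible closed of
codimension `≥ l` with generic point `v`: if `v ∉ W`, take `T = W` (a point of `Z ∩ W` is a strict
specialisation of `v`, of codimension `≥ l + 1`, Hartshorne II Ex. 3.20); if `v ∈ W`, the two closed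
sets `T`, `W'` of the hypothesis miss `v` and the kernel of `W` is covered by theirs.
[cite: VoisinHodgeII2003, §9.2.3 Lemma 9.18 (proof) and §9.2.4 Prop. 9.20]
[cite: Fulton1998, §2.3–2.4 and §19.2 Cor. 19.2] [cite: Hartshorne1977, II Ex. 3.20] -/
theorem cupProduct_mem_algebraicClasses_one_of_forall_primeDivisor
    (hX : Motives.IsSmoothProjective n X) {l : ℕ}
    (hdiv : ∀ ⦃W : Set X.left⦄, IsClosed W → IsIrreducible W →
      (∀ w ∈ W, ((1 : ℕ) : ℕ∞) ≤ Order.coheight w) → ∀ v ∈ W,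
        ∃ (W' T : Set X.left), IsClosed W' ∧ IsClosed T ∧ v ∉ W' ∧ v ∉ T ∧
          ∃ ψ ∈ LinearMap.ker (complexBetti.restrictCompl X T (2 * 1)).hom,
            LinearMap.ker (complexBetti.restrictCompl X W (2 * 1)).hom ≤
              Submodule.span ℂ {ψ} ⊔ LinearMap.ker (complexBetti.restrictCompl X W' (2 * 1)).hom)
    {a : complexBetti X (2 * l)} {d : complexBetti X (2 * 1)} (ha : a ∈ algebraicClasses X l)
    (hd : d ∈ algebraicClasses X 1) :
    cupProduct (two_mul_add_two_mul l 1) a d ∈ algebraicClasses X (l + 1) := by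
  refine cupProduct_mem_algebraicClasses_of_moving_right hX (fun Z W hZ hZi hZl hW hWi hW1 ↦ ?_) ha hd
  -- the generic point of `Z` and strict specialisation
  have hgen := hZi.isGenericPoint_genericPoint hZ
  set v := hZi.genericPoint with hv
  have hstrict : ∀ t ∈ Z, t ≠ v → ((l + 1 : ℕ) : ℕ∞) ≤ Order.coheight t := by
    intro t ht htv
    have hsp : v ⤳ t := hgen.specializes ht
    have hlt : t < v := by
      refine lt_of_le_not_ge (Scheme.le_iff_specializes.2 hsp) fun h' ↦ htv ?_
      exact ((Scheme.le_iff_specializes.1 h').antisymm hsp).eq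
    calc ((l + 1 : ℕ) : ℕ∞) = (l : ℕ∞) + 1 := by push_cast; rfl
      _ ≤ Order.coheight v + 1 := add_le_add (hZl v hgen.mem) le_rfl
      _ ≤ Order.coheight t := Order.coheight_add_one_le hlt
  -- a closed set missing `v` meets `Z` in codimension `≥ l + 1`
  have hgood : ∀ T : Set X.left, v ∉ T → ∀ t ∈ Z ∩ T, ((l + 1 : ℕ) : ℕ∞) ≤ Order.coheight t :=
    fun T hvT t ht ↦ hstrict t ht.1 fun h ↦ hvT (h ▸ ht.2)
  by_cases hvW : v ∈ W
  · -- move: `ker W ≤ ℂ ψ + ker W' ≤ ker T + ker W'`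
    obtain ⟨W', T, hW'c, hTc, hvW', hvT, ψ, hψ, hle⟩ := hdiv hW hWi hW1 v hvW
    refine hle.trans (sup_le ?_ ?_)
    · refine (Submodule.span_singleton_le_iff_mem _ _).2 ?_
      exact Submodule.mem_iSup_of_mem T (Submodule.mem_iSup_of_mem hTc
        (Submodule.mem_iSup_of_mem (hgood T hvT) hψ))
    · exact le_iSup_of_le W' (le_iSup_of_le hW'c (le_iSup_of_le (hgood W' hvW') le_rfl))
  · -- nothing to move
    exact le_iSup_of_le W (le_iSup_of_le hW (le_iSup_of_le (hgood W hvW) le_rfl))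

/-- **The divisor case from the hypersurface section through each PRIME DIVISOR only.** Same as
`cupProduct_mem_algebraicClasses_one_of_forall_primeDivisor`, the hypothesis being asked only for the
irreducible closed `W` whose generic point has codimension EXACTLY `1` (prime divisors): if the generic
point of `W` has codimension `≥ 2`, every point of `W` has codimension `≥ 2` and no non-zero class of
`H²(X(ℂ); ℂ)` dies on `(X ∖ W)(ℂ)` (semipurity, `injective_restrictCompl_of_le_coheight`), so the
hypothesis holds there with `W' = T = ∅`, `ψ = 0`. [cite: VoisinHodgeII2003, §9.2.3 Lemma 9.18 (proof) and §9.2.4 Prop. 9.20]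
[cite: GrothendieckTopology1969, §1] [cite: Hartshorne1977, II Ex. 3.20] -/
theorem cupProduct_mem_algebraicClasses_one_of_forall_primeDivisor'
    (hX : Motives.IsSmoothProjective n X) {l : ℕ}
    (hdiv : ∀ ⦃W : Set X.left⦄ (hW : IsClosed W) (hWi : IsIrreducible W),
      Order.coheight hWi.genericPoint = 1 → ∀ v ∈ W,
        ∃ (W' T : Set X.left), IsClosed W' ∧ IsClosed T ∧ v ∉ W' ∧ v ∉ T ∧
          ∃ ψ ∈ LinearMap.ker (complexBetti.restrictCompl X T (2 * 1)).hom,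
            LinearMap.ker (complexBetti.restrictCompl X W (2 * 1)).hom ≤
              Submodule.span ℂ {ψ} ⊔ LinearMap.ker (complexBetti.restrictCompl X W' (2 * 1)).hom)
    {a : complexBetti X (2 * l)} {d : complexBetti X (2 * 1)} (ha : a ∈ algebraicClasses X l)
    (hd : d ∈ algebraicClasses X 1) :
    cupProduct (two_mul_add_two_mul l 1) a d ∈ algebraicClasses X (l + 1) := by
  refine cupProduct_mem_algebraicClasses_one_of_forall_primeDivisor hX (fun W hW hWi hW1 v hv ↦ ?_) ha hd
  by_cases hη : Order.coheight hWi.genericPoint = 1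
  · exact hdiv hW hWi hη v hv
  · -- every point of `W` has codimension `≥ 2`: the kernel of `W` vanishes
    have hgen := hWi.isGenericPoint_genericPoint hW
    have hη2 : ((2 : ℕ) : ℕ∞) ≤ Order.coheight hWi.genericPoint := by
      have hlt : ((1 : ℕ) : ℕ∞) < Order.coheight hWi.genericPoint :=
        lt_of_le_of_ne (hW1 _ hgen.mem) (Ne.symm hη)
      have h2 : ((2 : ℕ) : ℕ∞) = ((1 : ℕ) : ℕ∞) + 1 := by push_cast; norm_num
      rw [h2]
      exact Order.add_one_le_of_lt hlt
    have hW2 : ∀ w ∈ W, ((2 : ℕ) : ℕ∞) ≤ Order.coheight w := fun w hw ↦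
      hη2.trans (Order.coheight_anti (Scheme.le_iff_specializes.2 (hgen.specializes hw)))
    have hinj := injective_restrictCompl_of_le_coheight hX hW hW2 (i := 2 * 1) (by omega)
    refine ⟨∅, ∅, isClosed_empty, isClosed_empty, Set.notMem_empty v, Set.notMem_empty v, 0,
      Submodule.zero_mem _, fun x hx ↦ ?_⟩
    have h0 : x = 0 := hinj (by rw [LinearMap.mem_ker.1 hx, map_zero])
    rw [h0]
    exact Submodule.zero_mem _

end HodgeTheory

end Literature.AlgebraicGeometry.HodgeTheory

end
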